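import Summits.BirchSwinnertonDyer.Rank1Residual.P2.CongruentNumberPairsAtTwoSelmerGenusBridge
import HarnessLib

/-!
# Sub-lane «bsd-p2»: the SELMER–GENUS BRIDGE at `2`, rank-zero side — EVEN TWIN `n = 2p₁⋯p_k ≡ 2 (mod 8)`
# (p2-typer GEN 6; companion of `CongruentNumberPairsAtTwoSelmerGenusBridge.lean`)

HONEST FRAMING (sub-lane «bsd-p2», run/shared/lean/b2b/bsd-rank1-residual/p2/, verbatim in every
file): the target of record is the FULL Birch–Swinnerton-Dyer formula for EVERY analytic-rank `≤ 1`
`E/ℚ` at ALL primes INCLUDING `2`; the odd-prime class ledger is referee A's; the `2`-part is OPEN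
(cells O1 = X5 ∖ CM and O12 = the CM corner) and under census by «bsd-p2». Census / instrument
output at `2` = EVIDENCE / conjecture items with held-out validation, NEVER a Literature fact;
certificates close PAIRS (one isogeny class, `p = 2`), never classes. This file asserts NO
arithmetic fact. FRAMING OF RECORD (p2-lead T-127 (ii), verbatim): an iff between two DECIDABLE bits,
CONDITIONAL modulo the five displayed facts; a NEW-IN-TREE-ONLY combination, not a printed theorem;
adds 0 n to (K); its value is as a CONSISTENCY INSTRUMENT for the typed p = 2 facts on the rank-0 side
(any square-free n ≡ 1, 2, 3 (8) with det ≠ [Σ₁ odd] refutes the conjunction AS TYPED) and as the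
precise rank-0 counterpart of the one-directional rank-1 genus criterion. Binders: `hMe` (Monsky 1994,
EVEN case `#Sel₂(E_{2m}) = 2^{2+s}` with `M = (Aᵀ + D₂, D₋₁; D₂, A + D₂)`), `hBT`, `hH`, `hBF`, `h11` — the
even s = 0 door's binders plus TYZ Thm 1.1. Nothing booked; no mark moved.

WHAT IT DOES. The odd file's `det M(n) = 1 ↔ Σ₁(n) odd` for `n = 2p₁⋯p_k ≡ 2 (mod 8)` and Monsky's EVEN
matrix: (⇒) via the even s = 0 door `bsdTriple_of_monsky_of_BT_BF_even`; (⇐) via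
`even_analyticRank_congruentNumberCurve` (sign `χ₋₄(n/2) = +1`), `hBF`, the proved bridge `#Ш = 𝓛(n)²`,
the descent count and `hMe`. Unit `b2b-bsdres-p2-typer` GEN 6; NEW file (p2-lead T-129). References:
[HeathBrown1994SelmerCongruentII] App. (Monsky) p. 41; [TianYuanZhang2017] Thm 1.1; [SilvermanAEC2009] X.4.2.
-/

open Matrix Finset NumberField WeierstrassCurve Literature.NumberTheory.EllipticCurves
  Literature.NumberTheory.EllipticCurves.HeathBrown1994 Literature.NumberTheory.EllipticCurves.TianYuanZhang2017

set_option autoImplicit false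

namespace Summit.BirchSwinnertonDyer.Rank1Residual.P2

section BridgeEven
variable {k : ℕ} (p : Fin k → ℕ)

/-- Even case: `s(n) = 0` forces `det M = 1` over `𝔽₂` (the kernel of `M` is trivial).
[cite: HeathBrown1994SelmerCongruentII, Appendix (Monsky), typescript p. 41 L36] -/
theorem det_monskyMatrixEven_eq_one_of_selmerRank_eq_zero
    (hs : monskySelmerRankEven p = 0) : (monskyMatrixEven p).det = 1 := by
  have hker := natCard_ker_mulVecLin_eq (monskyMatrixEven p)
  have hexp : Fintype.card (Fin k ⊕ Fin k) - (monskyMatrixEven p).rank = 0 := by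
    rw [Fintype.card_sum, Fintype.card_fin, ← two_mul]
    unfold monskySelmerRankEven at hs
    exact hs
  rw [hexp, pow_zero] at hker
  haveI := (Nat.card_eq_one_iff_unique.mp hker).1
  have hdet : (monskyMatrixEven p).det ≠ 0 := by
    intro h0
    obtain ⟨v, hv0, hv⟩ := Matrix.exists_mulVec_eq_zero_iff.mpr h0
    have hmem : v ∈ LinearMap.ker (monskyMatrixEven p).mulVecLin := by
      rw [LinearMap.mem_ker, Matrix.mulVecLin_apply]; exact hv
    have := Subsingleton.elim (⟨v, hmem⟩ : LinearMap.ker (monskyMatrixEven p).mulVecLin)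
      ⟨0, zero_mem _⟩
    exact hv0 (congrArg Subtype.val this)
  have h01 : ∀ x : ZMod 2, x ≠ 0 → x = 1 := by decide
  exact h01 _ hdet

/-- **(⇒, even) `s(2m) = 0 ⟹ Σ₁(2m)` odd** (`n = 2p₁⋯p_k ≡ 2 (mod 8)`; even s = 0 door, bridge, Thm 1.1).
[cite: HeathBrown1994SelmerCongruentII, Appendix (Monsky), typescript p. 41 L20–L36] [cite: TianYuanZhang2017, Thm. 1.1] -/
theorem odd_genusSum₁_of_det_monskyMatrixEven_eq_one (hMe : monsky_card_selmerGroup_two_even)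
    (hBT : burungaleTian_analyticRank_eq_zero_of_selmerCorank_eq_zero_of_hasCM)
    (hH : hasEntireLFunction_of_j_mem_maximalCMJInvariants)
    (hBF : bsdTriple_of_hasCM_of_L_one_ne_zero) (h11 : thm11_parity_of_scriptL)
    (hp : ∀ i, (p i).Prime) (hodd : ∀ i, Odd (p i)) (hinj : Function.Injective p)
    (h8 : (2 * ∏ i, p i) % 8 = 2) (hdet : (monskyMatrixEven p).det = 1) :
    Odd (genusSum₁ (2 * ∏ i, p i) fun d => genusClassNumber (GenusField d)) := by
  have hsq : Squarefree (2 * ∏ i, p i) := squarefree_two_mul_prod_of_injective p hp hodd hinj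
  haveI := isElliptic_congruentNumberCurve hsq.ne_zero
  obtain ⟨⟨hBSD, -, hr0⟩, hsha2⟩ :=
    bsdTriple_of_monsky_of_BT_BF_even p hMe hBT hH hBF hp hodd hinj hdet
  obtain ⟨-, hfin, hcard⟩ :=
    (bsdTriple_iff_rank_and_cardSha_eq_scriptLSq hsq (by rw [hr0]; exact zero_le_one)).mp hBSD
  haveI := hfin
  obtain ⟨L, hL, hpar⟩ :=
    h11 (2 * ∏ i, p i) hsq (Or.inr (Or.inl h8)) GenusField (isGenusFieldFamily_genusField _)
  have hShaOdd : Odd (Nat.card (congruentNumberCurve (2 * ∏ i, p i)).sha) :=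
    odd_natCard_of_primaryComponent_two_eq_bot hsha2
  rw [natCard_sha_eq_natAbs_sq hL hcard, pow_two, Nat.odd_mul] at hShaOdd
  have hLodd : Odd L := Int.natAbs_odd.mp hShaOdd.1
  rw [← ZMod.natCast_eq_one_iff_odd, ← hpar]
  exact (intCast_zmod_two_eq_one_iff_odd L).mpr hLodd

/-- **(⇐, even) `Σ₁(2m)` odd ⟹ `s(2m) = 0`** (Thm 1.1, even `r_an`, `hBF`, bridge, descent count, `hMe`).
[cite: TianYuanZhang2017, Thm. 1.1] [cite: KoblitzECMF1993, Ch. II §5, Theorem (p. 84)] [cite: SilvermanAEC2009, Thm. X.4.2] -/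
theorem det_monskyMatrixEven_eq_one_of_odd_genusSum₁ (hMe : monsky_card_selmerGroup_two_even)
    (hBF : bsdTriple_of_hasCM_of_L_one_ne_zero) (h11 : thm11_parity_of_scriptL)
    (hp : ∀ i, (p i).Prime) (hodd : ∀ i, Odd (p i)) (hinj : Function.Injective p)
    (h8 : (2 * ∏ i, p i) % 8 = 2)
    (hgen : Odd (genusSum₁ (2 * ∏ i, p i) fun d => genusClassNumber (GenusField d))) :
    (monskyMatrixEven p).det = 1 := by
  have hsq : Squarefree (2 * ∏ i, p i) := squarefree_two_mul_prod_of_injective p hp hodd hinj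
  haveI := isElliptic_congruentNumberCurve hsq.ne_zero
  haveI := isGloballyMinimal_congruentNumberCurve hsq
  have hE := hasEntireLFunction_congruentNumberCurve_holds hsq
  have h8' : (2 * ∏ i, p i) % 8 = 1 ∨ (2 * ∏ i, p i) % 8 = 2 ∨ (2 * ∏ i, p i) % 8 = 3 :=
    Or.inr (Or.inl h8)
  obtain ⟨L, hL, hpar⟩ := h11 (2 * ∏ i, p i) hsq h8' GenusField (isGenusFieldFamily_genusField _)
  have hLodd : Odd L := (intCast_zmod_two_eq_one_iff_odd L).mp
    (by rw [hpar]; exact ZMod.natCast_eq_one_iff_odd.mpr hgen)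
  have hL0 : (L : ℂ) ≠ 0 := by
    intro h
    have hz : L = 0 := by exact_mod_cast h
    rw [hz] at hLodd
    exact (by decide : ¬ Odd (0 : ℤ)) hLodd
  have hSq0 : scriptLSq (2 * ∏ i, p i) ≠ 0 := by
    unfold IsScriptL at hL
    rw [← hL]
    exact pow_ne_zero 2 hL0
  have hle := analyticRank_le_one_of_scriptLSq_ne_zero hSq0
  have heven := even_analyticRank_congruentNumberCurve hsq h8'
  have hr0 : (congruentNumberCurve (2 * ∏ i, p i)).analyticRank = 0 := by
    rcases Nat.le_one_iff_eq_zero_or_eq_one.mp hle with h | h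
    · exact h
    · exfalso; rw [h] at heven; exact Nat.not_even_one heven
  have hL1 : (congruentNumberCurve (2 * ∏ i, p i)).entireLFunction 1 ≠ 0 := fun h0 =>
    (analyticRank_ne_zero_of_entireLFunction_one_eq_zero (congruentNumberCurve _) hE h0) hr0
  have hBSD : (congruentNumberCurve (2 * ∏ i, p i)).BSDTriple :=
    hBF (congruentNumberCurve _) (LiLiuTian2024.hasCM_congruentNumberCurve _) hL1
  obtain ⟨hrank, -, hcard⟩ := (bsdTriple_iff_rank_and_cardSha_eq_scriptLSq hsq hle).mp hBSD
  have hrk : (congruentNumberCurve (2 * ∏ i, p i)).mordellWeilRank = 0 := by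
    unfold WeierstrassCurve.BSDRankFormula at hrank
    omega
  have hShaOdd : Odd (Nat.card (congruentNumberCurve (2 * ∏ i, p i)).sha) := by
    rw [natCard_sha_eq_natAbs_sq hL hcard]
    exact (Int.natAbs_odd.mpr hLodd).pow
  have hs0 : monskySelmerRankEven p = 0 :=
    selmerRank_eq_zero_of_rank_zero_of_odd_sha hsq.ne_zero hrk hShaOdd (hMe k p hp hodd hinj)
  exact det_monskyMatrixEven_eq_one_of_selmerRank_eq_zero p hs0

/-- **THE BRIDGE, EVEN TWIN.** For every `n = 2p₁⋯p_k ≡ 2 (mod 8)` (distinct odd primes, ANY `k`):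
`det (monskyMatrixEven p) = 1` (`s(n) = 0`) **iff** `Σ₁(n)` over `GenusField` is odd, modulo {`hMe`, `hBT`,
`hH`, `hBF`, `h11`}; NEW-IN-TREE-ONLY combination; `0` n to (K); a consistency instrument.
[cite: HeathBrown1994SelmerCongruentII, Appendix (Monsky), typescript p. 41 L20–L36] [cite: TianYuanZhang2017, Thm. 1.1] -/
theorem det_monskyMatrixEven_eq_one_iff_odd_genusSum₁ (hMe : monsky_card_selmerGroup_two_even)
    (hBT : burungaleTian_analyticRank_eq_zero_of_selmerCorank_eq_zero_of_hasCM)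
    (hH : hasEntireLFunction_of_j_mem_maximalCMJInvariants)
    (hBF : bsdTriple_of_hasCM_of_L_one_ne_zero) (h11 : thm11_parity_of_scriptL)
    (hp : ∀ i, (p i).Prime) (hodd : ∀ i, Odd (p i)) (hinj : Function.Injective p)
    (h8 : (2 * ∏ i, p i) % 8 = 2) :
    (monskyMatrixEven p).det = 1 ↔
      Odd (genusSum₁ (2 * ∏ i, p i) fun d => genusClassNumber (GenusField d)) :=
  ⟨odd_genusSum₁_of_det_monskyMatrixEven_eq_one p hMe hBT hH hBF h11 hp hodd hinj h8,
    det_monskyMatrixEven_eq_one_of_odd_genusSum₁ p hMe hBF h11 hp hodd hinj h8⟩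

end BridgeEven
end Summit.BirchSwinnertonDyer.Rank1Residual.P2
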